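import Literature.IUT.LogThetaLattice.PacketLogVolumesHaarModelRelative
import Literature.IUT.LogThetaLattice.PacketLogVolumesHaarModelCapsulesDegree
import HarnessLib

/-!
# [IUTchIII] Proposition 3.9 (iii), DEGREE clause, at the RELATIVE genuine adelic Haar model (`|A| = 1`): for an
# arithmetic line bundle `𝔍 = {J_v}_{v ∈ 𝕍_mod}` on `F_mod` realised in the packets `⊕_{v|v_ℚ} K_{v̲}` of `K ⊋ F_mod`,
# `μ^log_{𝕍_ℚ}(𝔍) = deg_{F_mod}(𝔍)/[F_mod:ℚ]` — for every `K ⊇ F_mod` and every section of places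
# (abc-iut cell, layer L6; row REL39, part R3 «degree clause», over part R2's assembly)

S. Mochizuki, *Inter-universal Teichmüller theory III*, kurims manuscript (May 2020), §3, Proposition 3.9 (iii), p. 117
[claim: Mochizuki2012, status: disputed]: "in the case of elements of `(†𝓕⊛_mod)_α` that arise as the image of objects
"`𝔍 = {𝔍_v}_{v∈𝕍}`" of `(†𝓕⊛_𝔪𝔬𝔡)_α` …, the global log-volume `μ^log_{A,𝕍_ℚ}(𝔍)` is equal to the degree of the arithmetic
line bundle determined by `𝔍` …, relative to a suitable normalization"; Remark 3.1.1 (ii), p. 94: "the normalized weight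
`1/([K_v : (F_mod)_v]·(Σ_{𝕍_mod ∋ w | v_ℚ} [(F_mod)_w : ℚ_{v_ℚ}]))`"; (i), p. 115: the integral structures have log-volume `0`.

WHAT THIS FILE ADDS. abc-iut-w5-d004's `PacketLogVolumesHaarModelRelative.lean` (p421634, part R2 of the row) is the
`|A| = 1` relative genuine model: sections `σ : GlobalPlaceSection F K` (`v ↦ v̲`), summands `K_{v̲}` (abc-iut-L6-t5's
`relPlaceDatum`, p421193) with Remark 3.1.1 (ii)'s weights `c_{v̲} = 1/([K_{v̲}:F_v]·[F:ℚ])`, `relHaarPacketLogVolume F K σ` and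
the INVARIANCE clause. abc-iut-L6-d3's `PacketLogVolumesHaarModelDegree.lean` (p416411) is the DEGREE clause at `K = F_mod`
(`IdealFamily F` = `𝔍`, `idealRegionAt`, `haarIdealRegion`, `globalLogVolume_haarIdealRegion = deg_F(𝔍)/[F:ℚ]`). Here the
degree clause at the RELATIVE model:
* `PlaceHaarDatum.Adm.comap` — an admissible region of the summand `K_{v̲}` is one of the pulled-back summand;
* **`relIdealRegionAt σ 𝔍 v ⊆ K_{v̲}`** — the realisation of `J_v` in `K_{v̲}`: at a finite `v`, `ϖ_v^{-n_v}·𝒪_{K_{v̲}} =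
  J_v·𝒪_{K_{v̲}}` (the unit ball of `K_{v̲}` — d3's `nonarchIdealRegion K v̲ 0`, log-volume `0` — multiplied through
  `F_mod → K ↪ K_{v̲}` by d3's GLOBAL generator `ϖ_v^{-n} ∈ F_mod^×`, `idealGenAt`); at an archimedean `w`, the disc
  `e^{t_w}·𝒪_ℂ ⊆ ℂ = K_{w̲}` (d3's `archIdealRegion K w̲ t_w`);
* **`relHaarWeight_mul_logVol_relIdealRegionAt`**: `c_{v̲}·μ^log_{K_{v̲}}(J_v·𝒪_{K_{v̲}}) = (1/[F:ℚ])·(𝔞_v·w_v)` — at a finite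
  `v`: `μ^log = [K_{v̲}:F_v]·n_v·log q_v` (t5's `log‖f‖_{K_{v̲}} = [K_{v̲}:F_v]·log‖f‖_v` at `f = ϖ_v^{-n}`) against the weight's
  `[K_{v̲}:F_v]^{-1}`; at an archimedean `w`: weight `[F_w:ℝ]/[F:ℚ]` (abc-iut-w5-d030's `relHaarWeight_inl_eq`, p421404) times
  `t_w` — i.e. EXACTLY d3's term `haarWeight F v · μ^log_v(J_v)` of the `K = F` model;
* `relHaarIdealRegion σ 𝔍` (a global region), **`relHaarPacketLogVolume_relHaarIdealRegion`** (packet by packet `=` d3's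
  `haarPacketLogVolume F q (haarIdealRegion F 𝔍)`), **`globalLogVolume_relHaarIdealRegion : μ^log_{𝕍_ℚ}(𝔍) = deg_F(𝔍)/[F:ℚ]`**
  (`= ndeg`), and **`prop39iii_degree_haarModelRel σ : Prop39iii_degree (relHaarPacketLogVolume F K σ) (relHaarIdealRegion σ)
  IdealFamily.deg`** with the normalisation constant `c = 1/[F_mod:ℚ]` — the same as at `K = F_mod` (p416411) and as for the
  relative capsules (`PacketLogVolumesHaarModelRelativeTensorDegree.lean`); unit family ↦ `0`; both clauses together.

HONEST SCOPE. `|A| = 1`; archimedean summand `ℂ` at every archimedean place with the uniform packet-normalised weight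
(p415871 (3), R1-arch); regions of `𝔍` = fractional ideals of `F_mod` extended to `K_{v̲}` through a global generator /
dilated discs (Example 3.6 (ii) objects; no Frobenioid is constructed). Nothing here bears on [IUTchIII] Cor. 3.12 or takes
a side; typed ≠ endorsed. Classical mathematics (Haar measure, `e·f = [K_w:F_v]`). [cite: NeukirchANT1999, Ch. II Prop. (8.5)]
-/

noncomputable section

namespace Literature.IUT.LogThetaLattice

open Literature.IUT.LogVolume NumberField IsDedekindDomain MeasureTheory Metric Set
open scoped ENNReal NNReal

/-! ### Admissible regions of a pulled-back summand -/

namespace PlaceHaarDatum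

variable {F K : Type} [Field F] [Field K]

/-- An admissible region of the summand `D = K_{v̲}` IS an admissible region of the pulled-back summand `D.comap φ` (same
carrier, same volume). [claim: Mochizuki2012, status: disputed] -/
def Adm.comap {D : PlaceHaarDatum K} (φ : F →+* K) (T : D.Adm) : (D.comap φ).Adm := ⟨T.1, T.2⟩

/-- Its log-volume is unchanged. [claim: Mochizuki2012, status: disputed] -/
@[simp] theorem logVol_admComap {D : PlaceHaarDatum K} (φ : F →+* K) (T : D.Adm) :
    (D.comap φ).logVol (Adm.comap φ T).1 = D.logVol T.1 := rfl

end PlaceHaarDatum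

variable {F K : Type} [Field F] [NumberField F] [Field K] [NumberField K] [Algebra F K] (σ : GlobalPlaceSection F K)

/-! ### The realisation of `𝔍 = {J_v}` in the summands `K_{v̲}` -/

/-- **The region of `J_v` in `K_{v̲}`**: at an archimedean `w`, the disc `e^{t_w}·𝒪_ℂ ⊆ ℂ = K_{w̲}`; at a finite `v`,
`ϖ_v^{-n_v}·𝒪_{K_{v̲}} = J_v·𝒪_{K_{v̲}}` — the unit ball of `K_{v̲}` multiplied, through `F_mod → K ↪ K_{v̲}`, by the global
generator `ϖ_v^{-n_v} ∈ F_mod^×` of `J_v = 𝔭_v^{-n_v}𝒪_v`. [claim: Mochizuki2012, status: disputed] -/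
def relIdealRegionAt (J : IdealFamily F) : ∀ v : Place F, (relPlaceDatum F K (σ.liftPlace v)).Adm
  | Sum.inl w => PlaceHaarDatum.Adm.comap (algebraMap F K) (archIdealRegion K (σ.liftArch w) (J.arch w))
  | Sum.inr v => (relPlaceDatum F K (Sum.inr (σ.lift v))).actAdm (idealGenAt F v (J.fin v))
      (PlaceHaarDatum.Adm.comap (algebraMap F K) (nonarchIdealRegion K (σ.lift v) 0))

/-- At an archimedean `w`: `μ^log(e^{t}·𝒪_ℂ) = t`. [claim: Mochizuki2012, status: disputed] -/
theorem logVol_relIdealRegionAt_inl (J : IdealFamily F) (w : InfinitePlace F) :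
    (relPlaceDatum F K (σ.liftPlace (Sum.inl w))).logVol (relIdealRegionAt σ J (Sum.inl w)).1 = J.arch w := by
  show ((archDatum K (σ.liftArch w)).comap (algebraMap F K)).logVol
    (PlaceHaarDatum.Adm.comap (algebraMap F K) (archIdealRegion K (σ.liftArch w) (J.arch w))).1 = _
  rw [PlaceHaarDatum.logVol_admComap, archIdealRegion_logVol]

/-- At a finite `v`: **`μ^log_{K_{v̲}}(J_v·𝒪_{K_{v̲}}) = [K_{v̲}:F_v]·n_v·log q_v`** (`μ^log(𝒪_{K_{v̲}}) = 0`, then t5's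
`log‖f‖_{K_{v̲}} = [K_{v̲}:F_v]·log‖f‖_v` at the generator `f = ϖ_v^{-n_v}`, `log‖ϖ_v^{-n}‖_v = n·log q_v`).
[claim: Mochizuki2012, status: disputed] -/
theorem logVol_relIdealRegionAt_inr (J : IdealFamily F) (v : HeightOneSpectrum (𝓞 F)) :
    (relPlaceDatum F K (σ.liftPlace (Sum.inr v))).logVol (relIdealRegionAt σ J (Sum.inr v)).1 =
      relLocalDegree F K (Sum.inr (σ.lift v)) * ((J.fin v : ℝ) * logNorm F v) := by
  show (relPlaceDatum F K (Sum.inr (σ.lift v))).logVol ((relPlaceDatum F K (Sum.inr (σ.lift v))).actAdm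
    (idealGenAt F v (J.fin v)) (PlaceHaarDatum.Adm.comap (algebraMap F K) (nonarchIdealRegion K (σ.lift v) 0))).1 = _
  have hU : (relPlaceDatum F K (Sum.inr (σ.lift v))).logVol
      (PlaceHaarDatum.Adm.comap (D := placeDatum K (Sum.inr (σ.lift v))) (algebraMap F K)
        (nonarchIdealRegion K (σ.lift v) 0)).1 = 0 := by
    show (nonarchDatum K (σ.lift v)).logVol (nonarchIdealRegion K (σ.lift v) 0).1 = 0
    rw [nonarchIdealRegion_logVol, Int.cast_zero, zero_mul]
  rw [PlaceHaarDatum.logVol_actAdm, log_modulus_relPlaceDatum_inr F K (σ.lift v) (idealGenAt F v (J.fin v)).ne_zero,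
    σ.finBelow_lift, placeDatum_inr F v, nonarchDatum_modulus F v, log_adicAbv_idealGenAt, hU, zero_add]

/-- **Per place, the relative weighted term IS d3's `K = F` term**: `c_{v̲}·μ^log_{K_{v̲}}(J_v·𝒪_{K_{v̲}}) =
(1/[F:ℚ])·(𝔞_v·w_v)` where `𝔞 = toADivisor 𝔍`, `w_v = log q_v` resp. `1` — the factor `[K_{v̲}:F_v]` of the log-volume
cancels the factor `[K_{v̲}:F_v]^{-1}` of Remark 3.1.1 (ii)'s weight; at `∞` the weight is `[F_w:ℝ]/[F:ℚ]` (R1-arch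
`relHaarWeight_inl_eq`). [claim: Mochizuki2012, status: disputed] -/
theorem relHaarWeight_mul_logVol_relIdealRegionAt (J : IdealFamily F) (v : Place F) :
    relHaarWeight F K (σ.liftPlace v) * (relPlaceDatum F K (σ.liftPlace v)).logVol (relIdealRegionAt σ J v).1 =
      (1 / Module.finrank ℚ F) * (J.toADivisor v * degWeight F v) := by
  rcases v with w | v
  · rw [logVol_relIdealRegionAt_inl, GlobalPlaceSection.liftPlace_inl, relHaarWeight_inl_eq, σ.comap_liftArch,
      haarWeight_inl, IdealFamily.toADivisor_inl, degWeight_inl]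
    ring
  · rw [logVol_relIdealRegionAt_inr, GlobalPlaceSection.liftPlace_inr, relHaarWeight_inr, IdealFamily.toADivisor_inr,
      degWeight_inr]
    have hr : (relLocalDegree F K (Sum.inr (σ.lift v)) : ℝ) ≠ 0 := by
      exact_mod_cast (relLocalDegree_pos F K (Sum.inr (σ.lift v))).ne'
    field_simp

/-- Equivalently: the relative weighted term equals d3's weighted term `c_v·μ^log_v(J_v)` of the `K = F` model (p416411
`haarWeight_mul_logVol_idealRegionAt`). [claim: Mochizuki2012, status: disputed] -/
theorem relHaarWeight_mul_logVol_relIdealRegionAt_eq (J : IdealFamily F) (v : Place F) :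
    relHaarWeight F K (σ.liftPlace v) * (relPlaceDatum F K (σ.liftPlace v)).logVol (relIdealRegionAt σ J v).1 =
      haarWeight F v * (placeDatum F v).logVol (idealRegionAt F J v).1 := by
  rw [relHaarWeight_mul_logVol_relIdealRegionAt, haarWeight_mul_logVol_idealRegionAt]

/-! ### The global region of `𝔍` and its global log-volume -/

/-- **The region "`𝔍`" of the global packet `𝓘^ℚ(^A𝓕_{𝕍_ℚ})` of `K` attached to `𝔍 = {J_v}`**: at `v_ℚ` the direct-product region
`∏_{v|v_ℚ} J_v·𝒪_{K_{v̲}} ⊆ ⊕_{v|v_ℚ} K_{v̲}` — a GLOBAL region (zero packet log-volume off the support of `𝔞_𝔍`, since packet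
by packet its log-volume is that of d3's `haarIdealRegion F 𝔍`). [claim: Mochizuki2012, status: disputed] -/
def relHaarIdealRegion (J : IdealFamily F) : GlobalRegion (relHaarPacketLogVolume F K σ) :=
  ⟨fun q v => relIdealRegionAt σ J v.1, by
    have h := (haarIdealRegion F J).2
    refine h.subset fun q hq => ?_
    rw [Function.mem_support] at hq ⊢
    simpa only [relHaarPacketLogVolume, relHaarWeight_mul_logVol_relIdealRegionAt_eq, haarPacketLogVolume,
      haarIdealRegion_apply] using hq⟩

/-- Components of the region of `𝔍`. [claim: Mochizuki2012, status: disputed] -/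
@[simp] theorem relHaarIdealRegion_apply (J : IdealFamily F) (q : RatPlace) (v : Packet F q) :
    (relHaarIdealRegion σ J).1 q v = relIdealRegionAt σ J v.1 := rfl

/-- **Packet by packet the relative log-volume of `𝔍` is d3's `K = F` packet log-volume of `𝔍`** (p416411).
[claim: Mochizuki2012, status: disputed] -/
theorem relHaarPacketLogVolume_relHaarIdealRegion (J : IdealFamily F) (q : RatPlace) :
    relHaarPacketLogVolume F K σ q ((relHaarIdealRegion σ J).1 q) = haarPacketLogVolume F q ((haarIdealRegion F J).1 q) := by
  simp only [relHaarPacketLogVolume, relHaarIdealRegion_apply, relHaarWeight_mul_logVol_relIdealRegionAt_eq,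
    haarPacketLogVolume, haarIdealRegion_apply]

/-- Hence `μ^log_{𝕍_ℚ}(𝔍)` at the relative model `= μ^log_{𝕍_ℚ}(𝔍)` at d3's `K = F` model. [claim: Mochizuki2012, status: disputed] -/
theorem globalLogVolume_relHaarIdealRegion_eq (J : IdealFamily F) :
    globalLogVolume (relHaarPacketLogVolume F K σ) (relHaarIdealRegion σ J) =
      globalLogVolume (haarPacketLogVolume F) (haarIdealRegion F J) := by
  unfold globalLogVolume
  exact finsum_congr fun q => relHaarPacketLogVolume_relHaarIdealRegion σ J q

/-- **`μ^log_{𝕍_ℚ}(𝔍) = deg_F(𝔍)/[F:ℚ]`** at the relative genuine model, for every `K ⊇ F_mod` and every section of places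
(p416411 `globalLogVolume_haarIdealRegion`). [claim: Mochizuki2012, status: disputed] -/
theorem globalLogVolume_relHaarIdealRegion (J : IdealFamily F) :
    globalLogVolume (relHaarPacketLogVolume F K σ) (relHaarIdealRegion σ J) = J.deg / Module.finrank ℚ F := by
  rw [globalLogVolume_relHaarIdealRegion_eq, globalLogVolume_haarIdealRegion]

/-- The same with the tree's normalised degree ([IUTchIV] Def. 1.9 (i)): `μ^log_{𝕍_ℚ}(𝔍) = deg(𝔞_𝔍)` on the nose.
[claim: Mochizuki2012, status: disputed] -/
theorem globalLogVolume_relHaarIdealRegion_eq_ndeg (J : IdealFamily F) :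
    globalLogVolume (relHaarPacketLogVolume F K σ) (relHaarIdealRegion σ J) = ndeg F J.toADivisor := by
  rw [globalLogVolume_relHaarIdealRegion_eq, globalLogVolume_haarIdealRegion_eq_ndeg]

/-- **IUTchIII:Prop3.9(iii)** (kurims p. 117) DEGREE CLAUSE AT THE RELATIVE GENUINE HAAR MODEL (`|A| = 1`; row REL39 part R3,
node IUTchIII:Prop3.9(iii)): for every extension of number fields `K ⊇ F_mod` and every section `σ : V̲ ⥲ 𝕍_mod`,
abc-iut-L6-t4's `Prop39iii_degree (relHaarPacketLogVolume F K σ) (relHaarIdealRegion σ) IdealFamily.deg` HOLDS with the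
normalisation constant `c = 1/[F_mod:ℚ]` — the SAME constant as at `K = F_mod` (p416411 `prop39iii_degree_haarModel`): "the
global log-volume … is equal to the degree of the arithmetic line bundle determined by `𝔍` …, relative to a suitable
normalization", the normalization being independent of `K` and of the section. [claim: Mochizuki2012, status: disputed] -/
theorem prop39iii_degree_haarModelRel :
    Prop39iii_degree (relHaarPacketLogVolume F K σ) (relHaarIdealRegion σ) IdealFamily.deg :=
  ⟨1 / Module.finrank ℚ F, div_pos one_pos (FinDivisor.finrank_pos (F := F)), fun J => by
    rw [globalLogVolume_relHaarIdealRegion, one_div, ← div_eq_inv_mul]⟩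

/-- The unit family `𝒪 = {𝒪_v}` realised in `K` (`𝒪_{K_{v̲}}` at every finite place, unit discs at `∞`) has global log-volume
`0` ("the log-volume of [the integral structures] … is equal to zero", Prop. 3.9 (i)). [claim: Mochizuki2012, status: disputed] -/
theorem globalLogVolume_relHaarIdealRegion_unit :
    globalLogVolume (relHaarPacketLogVolume F K σ) (relHaarIdealRegion σ IdealFamily.unit) = 0 := by
  rw [globalLogVolume_relHaarIdealRegion_eq, globalLogVolume_haarIdealRegion_unit]

/-- **Both clauses of Prop. 3.9 (iii) together at the relative model**: `f·𝔍` (each `J_v·𝒪_{K_{v̲}}` multiplied by `f ∈ F_mod^×`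
through `F_mod → K ↪ K_{v̲}`) has global log-volume `deg_F(𝔍)/[F:ℚ]` as well (part R2's
`globalLogVolume_relHaarPrincipalAction`). [claim: Mochizuki2012, status: disputed] -/
theorem globalLogVolume_relHaarPrincipalAction_relHaarIdealRegion (f : Fˣ) (J : IdealFamily F) :
    globalLogVolume (relHaarPacketLogVolume F K σ) (relHaarPrincipalAction F K σ f (relHaarIdealRegion σ J)) =
      J.deg / Module.finrank ℚ F := by
  rw [globalLogVolume_relHaarPrincipalAction, globalLogVolume_relHaarIdealRegion]

variable (F K) in
/-- Relative genuine models with the degree clause exist for every `K ⊇ F_mod` (sections of all places exist, part R2's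
`GlobalPlaceSection.nonempty`). [claim: Mochizuki2012, status: disputed] -/
theorem exists_prop39iii_degree_haarModelRel : ∃ σ : GlobalPlaceSection F K,
    Prop39iii_degree (relHaarPacketLogVolume F K σ) (relHaarIdealRegion σ) IdealFamily.deg := by
  obtain ⟨σ'⟩ := GlobalPlaceSection.nonempty (F := F) (K := K)
  exact ⟨σ', prop39iii_degree_haarModelRel σ'⟩

end Literature.IUT.LogThetaLattice

end
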